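import Summits.QuantumFields.BalabanUV.Beta.GAN24.StencilSlotSupRate

/-!
# `BalabanUV.Beta.GAN24.WSlotSupRate` — binder row G-an2-4 / (CONV-C), W-slot: the CAUCHY half `hWall` of the wall's second-order
# row needs NO off-diagonal input beyond the UNIFORM half `hW` — «W-Drift» ⇐ «W-Shape» ∧ a plain ONE-STEP SUP-NORM rate
# (the `VertexFamily₂` / `LocStencil₂` twin of gan24-p1's FINDINGS F-gan24p1-1 (K-slot, `CombesThomas.cauchyDecayK_of_unitDecayK_supRateK`)
# and F-gan24p1-3 (S-slot, `StencilSlotSupRate.locStencilCauchy_of_uniform_supRate`); G-an2-4 FORMAL swarm, leaf-01 lineage, gen 13)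

NOT IN PRINT; OUR PROOF ATTEMPT.  HONEST FRAMING (cell contract, verbatim): «discharging `BetaPertH` makes Bałaban's UV stability
UNCONDITIONAL — a real constructive-QFT result; it is NOT the continuum limit and NOT the Clay problem.»  HONEST DEPENDENCY (verbatim):
«continuum YM on T⁴ ⇐ BetaPertH ∧ nine spine estimates (0/9 proved); BetaPertH ⇐ (D1) ∧ (D4) ∧ CAP+tail; G-an2-4 gates asym, D1 and
NE2/3/4.»  [folklore] real analysis only: `min ≤ geometric mean` (`StencilSlotSupRate.biLoc_half_of_supBound`, i.e. King's
`abs_le_sqrt_mul_exp_half` BY NAME) + the geometric series (`CombesThomas.supCauchy_of_supRate` BY NAME).  No estimate on an2's objects, no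
cited fact, no `def`, no `Prop` mirror; every shape below is a HYPOTHESIS with free constants; 0 wall binders instantiated.  NOT summit progress.

## Where this sits
asym1's wall `HessKerConvCKPlug.d1Drift_JsBalOf_iff_of_convCKWall` (re-posed in one-step leg units by `HessKerDressedUnitsWall`) asks for
four binder families: the K-rows (tree theorems for `Lc ≥ 2`, `KSlotAssembly.convCKWall_holds`), the S-rows `(hS, hSall)` (road «S3»: all
twelve analytic rows are tree theorems at `d = 3` — `StencilSlotSAllThree`), and an2's W-rows
`hW : ∀ j, VertexFamily₂ (unitW (s_f j) (s_m j) (W j)) Lc Cw δW` (UNIFORM) and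
`hWall : ∀ k j, VertexFamily₂ (unitW (s_f (k+j)) (s_m (k+j)) (W (k+j)) − unitW (s_f k) (s_m k) (W k)) Lc (cW·θW^k) δW` (CAUCHY).
leaf-07's `GAN24/WSlotOfShapes` reduces the UNIFORM half for an2's family `WbalOf` to one located shape «T2Shape».  THIS module settles
the form of the CAUCHY half: it follows from the uniform half and an ENTRYWISE one-step sup-norm rate of the normalised tables — no
decay is asked of the differences, exactly as for the K-slot ((I2′) was a real-zone sup estimate) and the S-slot («E3SupRate»).

## What is proved (all [folklore])
* §1 generic, an2's coarse-bond currency `VertexFamily₂` (`MKer D F`): `vertexFamily₂_half_of_supBound` (bi-localised family with constant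
  `Cw` at rate `δ` whose members are sup-bounded by `ε` ⇒ constant `√(ε·Cw)` at rate `δ/2`), `vertexFamily₂_sub'`, and
  **`vertexFamily₂Cauchy_of_uniform_supRate`**: `∀ n, VertexFamily₂ (W n) N Cw δ` and
  `|W (n+1) μ y ν y′ x z a b − W n μ y ν y′ x z a b| ≤ c·θ^n` (`0 ≤ c`, `0 ≤ θ < 1`) give
  `∀ k j, VertexFamily₂ (W (k+j) − W k) N (√(2(c/(1−θ))Cw)·(√θ)^k) (δ/2)`.
* §2 the same for an2's fine bi-stencil currency `LocStencil₂` (the currency of leaf-07's «T2Shape»; the separation weight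
  `e^{−δ|u′−u|}` is halved together with the locality rate): `locStencil₂_half_of_supBound`, `locStencil₂_sub'`,
  **`locStencil₂Cauchy_of_uniform_supRate`**.
* §3 THE W-SLOT APPLICATION (any leg units `s_f, s_m : ℕ → ℝ`, any table family `W : ℕ → …`, generic `d`): **`hWall_of_hW_supRate`** — the
  wall's CAUCHY W-row at `(√(2(c/(1−θ))Cw), √θ, δW/2)` from the UNIFORM W-row `(Cw, δW)` and the sup-norm rate `(c, θ)`; and the packaged
  binder block **`hW_hWall_of_hW_supRate`**: `∃ Cw′ cW δW′ θW, 0 < δW′ ∧ 0 ≤ θW ∧ θW < 1 ∧ hW(Cw′, δW′) ∧ hWall(cW·θW^k, δW′)` — LITERALLY the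
  five W-binders `{Cw₂ cW δW θW} (hW₂) (hW₂all) (hδW) (hθW0) (hθW1)` of `StencilSlotWallPlug.d1Drift_JsBalOf_iff_of_e3Shapes` /
  `StencilSlotWallThree.d1Drift_JsBalOf_iff_three_of_diffRows` (units `sfStep`, `smStep d` in `hW_hWall_step_of_hW_supRate`), and the `hW`/`hWall`
  pair of `HessKerDressedUnitsWall.d1Drift_JsBalOf_iff_of_cauchy_unit` (any units).
So the located pair of the W-slot is «W-Shape» (leaf-07: ⇐ «T2Shape») + a SUP-NORM one-step rate of the normalised second-order tables.

HONEST: reductions only; discharges NOTHING of (hW, hWall) unconditionally; NOT «W-slot closed», NEVER «G-an2-4 closed»; NOT BetaPertH,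
NOT continuum, NOT Clay.
-/

noncomputable section

open Literature.MathematicalPhysics.QuantumFieldTheory
open Literature.MathematicalPhysics.QuantumFieldTheory.Balaban1983to89
open Literature.MathematicalPhysics.QuantumFieldTheory.Balaban1983to89.Beta
open B12Sec2to5 (l1 l1_nonneg)
open ExpKernelCalculus (MKer BiLoc VertexFamily₂)
open OneStepResolventKernel (Fib)
open BalabanCompositeJets (LocStencil₂)
open Summit.QuantumFields.BalabanUV.Beta.HessKerDressedUnits (unitW)
open Summit.QuantumFields.BalabanUV.Beta.GAN24.CombesThomas (SupBound SupCauchy supCauchy_of_supRate sqrt_pow_eq sqrt_rate_lt_one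
  sfStep smStep)
open Summit.QuantumFields.BalabanUV.Beta.GAN24.StencilSlotSupRate (biLoc_half_of_supBound biLoc_sub')

namespace Summit.QuantumFields.BalabanUV.Beta.GAN24.WSlotSupRate

/-! ## §1 Generic: an2's coarse-bond currency `VertexFamily₂` -/

section VertexFamily

variable {D : ℕ} {F : Type*}

/-- [folklore] **INTERPOLATION FOR A SECOND-ORDER VERTEX FAMILY**: `VertexFamily₂ W N Cw δ` and `|W μ y ν y′| ≤ ε` entrywise for every
member give `VertexFamily₂ W N √(ε·Cw) (δ/2)` (`StencilSlotSupRate.biLoc_half_of_supBound` member by member). -/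
theorem vertexFamily₂_half_of_supBound {W : Fin D → (Fin D → ℤ) → Fin D → (Fin D → ℤ) → MKer D F} {N : ℕ} {Cw δ ε : ℝ}
    (h : VertexFamily₂ W N Cw δ) (hε : 0 ≤ ε) (hsup : ∀ μ y ν y', SupBound (W μ y ν y') ε) :
    VertexFamily₂ W N (Real.sqrt (ε * Cw)) (δ / 2) :=
  fun μ y ν y' => biLoc_half_of_supBound (h μ y ν y') hε (hsup μ y ν y')

/-- [folklore] Difference of two second-order vertex families localised at the same coarse bonds (constants add). -/
theorem vertexFamily₂_sub' {W W' : Fin D → (Fin D → ℤ) → Fin D → (Fin D → ℤ) → MKer D F} {N : ℕ} {Cw Cw' δ : ℝ}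
    (h : VertexFamily₂ W N Cw δ) (h' : VertexFamily₂ W' N Cw' δ) : VertexFamily₂ (W - W') N (Cw + Cw') δ :=
  fun μ y ν y' => by simpa only [Pi.sub_apply] using biLoc_sub' (h μ y ν y') (h' μ y ν y')

/-- [folklore] **UNIFORM LOCALISATION + ONE-STEP SUP-NORM RATE ⇒ THE WALL'S WEIGHTED CAUCHY SHAPE** for a sequence of second-order
vertex families `W : ℕ → …` (`0 ≤ c`, `0 ≤ θ < 1`): `∀ k j, VertexFamily₂ (W (k+j) − W k) N (√(2(c/(1−θ))Cw)·(√θ)^k) (δ/2)`.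
No decay is asked of the differences. -/
theorem vertexFamily₂Cauchy_of_uniform_supRate {W : ℕ → Fin D → (Fin D → ℤ) → Fin D → (Fin D → ℤ) → MKer D F} {N : ℕ}
    {Cw δ c θ : ℝ} (hW : ∀ n, VertexFamily₂ (W n) N Cw δ)
    (hR : ∀ (n : ℕ) (μ : Fin D) (y : Fin D → ℤ) (ν : Fin D) (y' : Fin D → ℤ), SupBound (W (n + 1) μ y ν y' - W n μ y ν y') (c * θ ^ n))
    (hc : 0 ≤ c) (hθ0 : 0 ≤ θ) (hθ1 : θ < 1) (k j : ℕ) :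
    VertexFamily₂ (W (k + j) - W k) N (Real.sqrt (2 * (c / (1 - θ)) * Cw) * Real.sqrt θ ^ k) (δ / 2) := by
  intro μ y ν y'
  -- sup-norm Cauchy bound for the entry sequence `n ↦ W n μ y ν y'`
  have hsc : SupCauchy (fun n => W n μ y ν y') (c / (1 - θ)) θ := supCauchy_of_supRate (fun n => hR n μ y ν y') hc hθ0 hθ1
  have hsup : SupBound (W (k + j) μ y ν y' - W k μ y ν y') (c / (1 - θ) * θ ^ k) := hsc k j
  -- localisation of the difference with the crude constant `2·Cw`
  have hloc : BiLoc (W (k + j) μ y ν y' - W k μ y ν y') ((N : ℤ) • y) ((N : ℤ) • y') (Cw + Cw) δ :=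
    biLoc_sub' (hW (k + j) μ y ν y') (hW k μ y ν y')
  have hε : 0 ≤ c / (1 - θ) * θ ^ k := mul_nonneg (div_nonneg hc (by linarith)) (pow_nonneg hθ0 k)
  have h := biLoc_half_of_supBound hloc hε hsup
  have e : Real.sqrt (c / (1 - θ) * θ ^ k * (Cw + Cw)) = Real.sqrt (2 * (c / (1 - θ)) * Cw) * Real.sqrt θ ^ k := by
    rw [show c / (1 - θ) * θ ^ k * (Cw + Cw) = (2 * (c / (1 - θ)) * Cw) * θ ^ k by ring, Real.sqrt_mul' _ (pow_nonneg hθ0 k),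
      sqrt_pow_eq hθ0]
  rw [e] at h
  simpa only [Pi.sub_apply] using h

end VertexFamily

/-! ## §2 Generic: an2's fine bi-stencil currency `LocStencil₂` (the currency of «T2Shape») -/

section BiStencil

variable {d : ℕ}

/-- [folklore] `√(C·e^{−δ s}) = √C · e^{−(δ/2) s}`. -/
theorem sqrt_mul_exp_neg (C δ s : ℝ) : Real.sqrt (C * Real.exp (-δ * s)) = Real.sqrt C * Real.exp (-(δ / 2) * s) := by
  have hh : Real.exp (-δ * s) = Real.exp (-(δ / 2) * s) * Real.exp (-(δ / 2) * s) := by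
    rw [← Real.exp_add]; ring_nf
  rw [Real.sqrt_mul' _ (Real.exp_pos _).le, hh, Real.sqrt_mul_self (Real.exp_pos _).le]

/-- [folklore] **INTERPOLATION FOR A FINE BI-STENCIL FAMILY**: `LocStencil₂ S₂ C δ` and `|S₂ κ u κ′ u′| ≤ ε` entrywise for every member give
`LocStencil₂ S₂ √(ε·C) (δ/2)` — the separation weight `e^{−δ|u′−u|}` is halved together with the locality rate. -/
theorem locStencil₂_half_of_supBound
    {S₂ : Fin (d + 1) → (Fin (d + 1) → ℤ) → Fin (d + 1) → (Fin (d + 1) → ℤ) → MKer (d + 1) (Fib d)} {C δ ε : ℝ}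
    (h : LocStencil₂ S₂ C δ) (hε : 0 ≤ ε) (hsup : ∀ κ u κ' u', SupBound (S₂ κ u κ' u') ε) :
    LocStencil₂ S₂ (Real.sqrt (ε * C)) (δ / 2) := by
  intro κ u κ' u'
  have h1 := biLoc_half_of_supBound (h κ u κ' u') hε (hsup κ u κ' u')
  rwa [← mul_assoc, sqrt_mul_exp_neg] at h1

/-- [folklore] Difference of two fine bi-stencil families with the same rate (constants add). -/
theorem locStencil₂_sub'
    {S₂ S₂' : Fin (d + 1) → (Fin (d + 1) → ℤ) → Fin (d + 1) → (Fin (d + 1) → ℤ) → MKer (d + 1) (Fib d)} {C C' δ : ℝ}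
    (h : LocStencil₂ S₂ C δ) (h' : LocStencil₂ S₂' C' δ) : LocStencil₂ (S₂ - S₂') (C + C') δ := by
  intro κ u κ' u'
  have h1 := biLoc_sub' (h κ u κ' u') (h' κ u κ' u')
  rw [← add_mul] at h1
  simpa only [Pi.sub_apply] using h1

/-- [folklore] **UNIFORM BI-STENCIL LOCALISATION + ONE-STEP SUP-NORM RATE ⇒ WEIGHTED CAUCHY SHAPE** for a sequence of fine bi-stencil
families `T : ℕ → …` (`0 ≤ c`, `0 ≤ θ < 1`): `∀ k j, LocStencil₂ (T (k+j) − T k) (√(2(c/(1−θ))C)·(√θ)^k) (δ/2)`.  («T2Drift» ⇐ «T2Shape» ∧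
«T2SupRate» in leaf-07's currency; no decay is asked of the differences.) -/
theorem locStencil₂Cauchy_of_uniform_supRate
    {T : ℕ → Fin (d + 1) → (Fin (d + 1) → ℤ) → Fin (d + 1) → (Fin (d + 1) → ℤ) → MKer (d + 1) (Fib d)} {C δ c θ : ℝ}
    (hT : ∀ n, LocStencil₂ (T n) C δ)
    (hR : ∀ (n : ℕ) (κ : Fin (d + 1)) (u : Fin (d + 1) → ℤ) (κ' : Fin (d + 1)) (u' : Fin (d + 1) → ℤ),
      SupBound (T (n + 1) κ u κ' u' - T n κ u κ' u') (c * θ ^ n))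
    (hc : 0 ≤ c) (hθ0 : 0 ≤ θ) (hθ1 : θ < 1) (k j : ℕ) :
    LocStencil₂ (T (k + j) - T k) (Real.sqrt (2 * (c / (1 - θ)) * C) * Real.sqrt θ ^ k) (δ / 2) := by
  -- sup-norm Cauchy bound, member by member
  have hsup : ∀ κ u κ' u', SupBound ((T (k + j) - T k) κ u κ' u') (c / (1 - θ) * θ ^ k) := by
    intro κ u κ' u'
    have hsc : SupCauchy (fun n => T n κ u κ' u') (c / (1 - θ)) θ :=
      supCauchy_of_supRate (fun n => hR n κ u κ' u') hc hθ0 hθ1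
    simpa only [Pi.sub_apply] using hsc k j
  have hε : 0 ≤ c / (1 - θ) * θ ^ k := mul_nonneg (div_nonneg hc (by linarith)) (pow_nonneg hθ0 k)
  have h := locStencil₂_half_of_supBound (locStencil₂_sub' (hT (k + j)) (hT k)) hε hsup
  have e : Real.sqrt (c / (1 - θ) * θ ^ k * (C + C)) = Real.sqrt (2 * (c / (1 - θ)) * C) * Real.sqrt θ ^ k := by
    rw [show c / (1 - θ) * θ ^ k * (C + C) = (2 * (c / (1 - θ)) * C) * θ ^ k by ring, Real.sqrt_mul' _ (pow_nonneg hθ0 k),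
      sqrt_pow_eq hθ0]
  rw [e] at h
  exact h

end BiStencil

/-! ## §3 The W-slot application: the wall's Cauchy W-row from the uniform W-row and a sup-norm one-step rate -/

section WSlot

variable {d : ℕ} {Lc : ℕ}

/-- **«W-Drift» ⇐ «W-Shape» ∧ «W-SupRate»** [folklore] (any leg units `s_f, s_m`, any table family `W`): if the normalised second-order
tables `W♮ j := unitW (s_f j) (s_m j) (W j)` are `j`-uniformly bi-localised at the coarse bonds (`Cw`, `δW` — the wall's binder `hW`) and
converge at a one-step SUP-NORM rate `|W♮ (j+1) μ y ν y′ x z a b − W♮ j μ y ν y′ x z a b| ≤ c·θ^j` (`0 ≤ c`, `0 ≤ θ < 1`; no decay asked),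
then the wall's CAUCHY binder `hWall` holds with constant `√(2(c/(1−θ))Cw)·(√θ)^k` at locality rate `δW/2`. -/
theorem hWall_of_hW_supRate (sf sm : ℕ → ℝ)
    (W : ℕ → Fin (d + 1) → (Fin (d + 1) → ℤ) → Fin (d + 1) → (Fin (d + 1) → ℤ) → MKer (d + 1) (Fib d)) {Cw δW c θ : ℝ}
    (hW : ∀ j, VertexFamily₂ (unitW (sf j) (sm j) (W j)) Lc Cw δW)
    (hR : ∀ (j : ℕ) (μ : Fin (d + 1)) (y : Fin (d + 1) → ℤ) (ν : Fin (d + 1)) (y' : Fin (d + 1) → ℤ),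
      SupBound (unitW (sf (j + 1)) (sm (j + 1)) (W (j + 1)) μ y ν y' - unitW (sf j) (sm j) (W j) μ y ν y') (c * θ ^ j))
    (hc : 0 ≤ c) (hθ0 : 0 ≤ θ) (hθ1 : θ < 1) (k j : ℕ) :
    VertexFamily₂ (unitW (sf (k + j)) (sm (k + j)) (W (k + j)) - unitW (sf k) (sm k) (W k)) Lc
      (Real.sqrt (2 * (c / (1 - θ)) * Cw) * Real.sqrt θ ^ k) (δW / 2) :=
  vertexFamily₂Cauchy_of_uniform_supRate (W := fun n => unitW (sf n) (sm n) (W n)) hW hR hc hθ0 hθ1 k j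

/-- **THE WALL'S W-BINDER BLOCK FROM «W-Shape» ∧ «W-SupRate»** [folklore] (any leg units, any table family, `0 < δW`): the five W-binders
`{Cw₂ cW δW θW} (hW₂) (hW₂all) (hδW) (hθW0) (hθW1)` of `StencilSlotWallPlug.d1Drift_JsBalOf_iff_of_e3Shapes` /
`StencilSlotWallThree.d1Drift_JsBalOf_iff_three_of_diffRows` (and the `hW`/`hWall` pair of `HessKerDressedUnitsWall.d1Drift_JsBalOf_iff_of_cauchy_unit`),
∃-packaged at ONE common locality rate: witnesses `(Cw, √(2(c/(1−θ))Cw), δW/2, √θ)`. -/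
theorem hW_hWall_of_hW_supRate (sf sm : ℕ → ℝ)
    (W : ℕ → Fin (d + 1) → (Fin (d + 1) → ℤ) → Fin (d + 1) → (Fin (d + 1) → ℤ) → MKer (d + 1) (Fib d)) {Cw δW c θ : ℝ}
    (hW : ∀ j, VertexFamily₂ (unitW (sf j) (sm j) (W j)) Lc Cw δW)
    (hR : ∀ (j : ℕ) (μ : Fin (d + 1)) (y : Fin (d + 1) → ℤ) (ν : Fin (d + 1)) (y' : Fin (d + 1) → ℤ),
      SupBound (unitW (sf (j + 1)) (sm (j + 1)) (W (j + 1)) μ y ν y' - unitW (sf j) (sm j) (W j) μ y ν y') (c * θ ^ j))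
    (hc : 0 ≤ c) (hθ0 : 0 ≤ θ) (hθ1 : θ < 1) (hδW : 0 < δW) :
    ∃ Cw₂ cW δW' θW : ℝ, 0 < δW' ∧ 0 ≤ θW ∧ θW < 1 ∧
      (∀ j, VertexFamily₂ (unitW (sf j) (sm j) (W j)) Lc Cw₂ δW') ∧
      (∀ k j, VertexFamily₂ (unitW (sf (k + j)) (sm (k + j)) (W (k + j)) - unitW (sf k) (sm k) (W k)) Lc (cW * θW ^ k) δW') := by
  have hCw : 0 ≤ Cw := ((hW 0) 0 0 0 0).nonneg (Sum.inl 0)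
  exact ⟨Cw, Real.sqrt (2 * (c / (1 - θ)) * Cw), δW / 2, Real.sqrt θ, half_pos hδW, Real.sqrt_nonneg θ, sqrt_rate_lt_one hθ1,
    fun j => BalabanStepJets.vertexFamily₂_mono (hW j) hCw (by linarith),
    fun k j => hWall_of_hW_supRate sf sm W hW hR hc hθ0 hθ1 k j⟩

/-- **THE WALL'S W-BINDER BLOCK IN THE ONE-STEP UNITS `(sfStep Lc j, smStep d Lc j) = (Lc^j, Lc^{j(d+1)})`** [folklore]: the instance of
`hW_hWall_of_hW_supRate` at gan24-p1's K-slot units — the literal W-binder block of `StencilSlotWallThree.d1Drift_JsBalOf_iff_three_of_diffRows`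
(`d = 3`) / `StencilSlotWallPlug.d1Drift_JsBalOf_iff_of_e3Shapes`. -/
theorem hW_hWall_step_of_hW_supRate
    (W : ℕ → Fin (d + 1) → (Fin (d + 1) → ℤ) → Fin (d + 1) → (Fin (d + 1) → ℤ) → MKer (d + 1) (Fib d)) {Cw δW c θ : ℝ}
    (hW : ∀ j, VertexFamily₂ (unitW (sfStep Lc j) (smStep d Lc j) (W j)) Lc Cw δW)
    (hR : ∀ (j : ℕ) (μ : Fin (d + 1)) (y : Fin (d + 1) → ℤ) (ν : Fin (d + 1)) (y' : Fin (d + 1) → ℤ),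
      SupBound (unitW (sfStep Lc (j + 1)) (smStep d Lc (j + 1)) (W (j + 1)) μ y ν y' -
        unitW (sfStep Lc j) (smStep d Lc j) (W j) μ y ν y') (c * θ ^ j))
    (hc : 0 ≤ c) (hθ0 : 0 ≤ θ) (hθ1 : θ < 1) (hδW : 0 < δW) :
    ∃ Cw₂ cW δW' θW : ℝ, 0 < δW' ∧ 0 ≤ θW ∧ θW < 1 ∧
      (∀ j, VertexFamily₂ (unitW (sfStep Lc j) (smStep d Lc j) (W j)) Lc Cw₂ δW') ∧
      (∀ k j, VertexFamily₂ (unitW (sfStep Lc (k + j)) (smStep d Lc (k + j)) (W (k + j)) -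
        unitW (sfStep Lc k) (smStep d Lc k) (W k)) Lc (cW * θW ^ k) δW') :=
  hW_hWall_of_hW_supRate (sfStep Lc) (smStep d Lc) W hW hR hc hθ0 hθ1 hδW

end WSlot

end Summit.QuantumFields.BalabanUV.Beta.GAN24.WSlotSupRate

end
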